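import Summits.Ventures.LatticeQCDFlow.Scaling.HubClassStartContentDeficitEnum
import Summits.Ventures.LatticeQCDFlow.Scaling.TaggedStartContentCover

/-!
HONEST FRAMING: exact (Metropolis-corrected) sampling algorithms for lattice gauge theory; figures
of merit are autocorrelation/cost numbers at stated couplings and volumes; no continuum-physics
claim.

# TaggedStartContentDeficitSharp — THE SHARP START-CONTENT DEFICIT BOUNDS FOR W26'S TAGGED CHAINS (EXTRA PARTICLES ADJACENT IN DEPTH): WITH `γ = P_X(z,z) − P_Y(z,z)`,
# `q = max{0, N_C(z)/K − P_X(z,z)}`: (A) HUB CONTENT AT MOST AS PERSISTENT AS `b`, STRICTLY LESS THAN `a`, THREE PARTICLES AT OR ABOVE IT ⇒ `y_{n+1}(z) − x_{n+1}(z) ≤ 𝟙{n odd}γqⁿ` AND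
# `Σ_{n<J}(1−σ)σⁿ(y_{n+1}(z)−x_{n+1}(z))⁺ ≤ (1−σ)γσq/(1−σ²q²)`; (B) HUB CONTENT ALONE, DIRECTLY BELOW THE EXTRA PARTICLES ⇒ `≤ 𝟙{n odd}K^{−(n+1)}acc(z,a)/(1+acc(z,a))` AND ITS SUM;
# (C) HUB CONTENT STRICTLY MORE PERSISTENT THAN `a`, THREE PARTICLES ABOVE `b` ⇒ NO DEFICIT; (D) HUB CONTENT ALONE ABOVE BOTH EXTRA PARTICLES ⇒ `≤ 𝟙{n even}K^{−(n+1)}·t/(1+t)`,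
# `t = W_b/W_z`, AND ITS SUM (lean-2 GEN-41, ours)

Venture-side (OURS).  Cell `lqcd-flow` (pub-lqcd), unit `pub-lqcd-lean-2-g41`, 2026-08-30.  Chapter AA (route (β), the cost side), file 6 = file 5 instantiated for the tagged hub chains of
W14∕W26 exactly as Z12 instantiated Z11 (chapter W's data on the content type `Option S`, Z4 `tagged_kernel_eq`, a common enumeration sorted by the key `W^X + W^Y`, Z3).  The three
configurations are read off STRICT persistence inequalities (robust to the enumeration's tie-breaking): (A) `W_z ≤ W_b`, `W_z < W_a` and (`N_C(z) ≥ 2` or some present content is strictly more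
persistent than `z`); (B) `N_C(z) = 1`, `W_z ≤ W_b`, `W_z < W_a`, every other present content strictly below `W_z` (the tie `W_b = W_z` of MEMO-gen40's extremal family INCLUDED); (C) `W_a < W_z` and (`N_C(z) ≥ 2` or some other present content lies strictly
above `W_b`).  Here `x_n, y_n` are the `n`-attempt
laws from the ordinary hub `z` and `D = Σ_j w_j(y_j(z) − x_j(z))⁺` (`w_j = (1−σ)σʲ⁻¹`) is the discounted start-content deficit of MEMO-gen40 §4:

* (A): per step and discounted (`D ≤ (1−σ)γσq/(1−σ²q²)`, `γ = (acc(z,b) − acc(z,a))/K`, `q ≤ acc(z,a)/K`);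
* (B): per step and discounted (`D ≤ (1−σ)·(acc(z,a)/(1+acc(z,a)))·(1/K)·(σ/K)/(1−σ²/K²)`);
* (C): `y_n(z) ≤ x_n(z)` for every `n` (`D = 0`); (D) (`W_a < W_z`, `N_C(z) = 1`, every other present content strictly below `W_b`): per step (odd steps only) and discounted
  (`D ≤ (1−σ)·(t/(1+t))·(1/K)/(1−σ²/K²)`, `t = W_b/W_z`) — all four as ONE conjunction `tagged_startClass_deficit`.

A content tied with `z` other than `b` is ranked either side of `z` by the enumeration; file 5 then still applies in one of its configurations (not instantiated here).  Literature grade (cell rule): OWN, plumbing; nothing cited; no new bib keys.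
-/

open Finset

namespace Summit.Ventures.LatticeQCDFlow.Scaling

section TaggedDeficit
variable {S : Type*} [Fintype S] [DecidableEq S]
variable {W : S → ℝ} {acc : S → S → ℝ} {K : ℕ} {NC : S → ℕ} {a b : S} {PX PY : Option S → Option S → ℝ}

/-- **The three sharp deficit statements for the tagged chains of a depth-adjacent pair** (conjunction; see the module docstring). [ours] -/
theorem tagged_startClass_deficit (hW : ∀ v, 0 < W v) (hacc : ∀ h v, acc h v = min 1 (W h / W v)) (hK : 2 ≤ K) (hNC : ∑ v, NC v = K) (hab : W b ≤ W a)
    (hnone : ∀ w, NC w ≠ 0 → ¬ (W b < W w ∧ W w < W a))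
    (hPXoff : ∀ h v, h ≠ v → PX (some h) (some v) = if NC h = 0 then 0 else (NC v : ℝ) / K * acc h v)
    (hPXin : ∀ h, PX (some h) none = if NC h = 0 then 0 else acc h a / K)
    (hPXdiag : ∀ h, PX (some h) (some h) = 1 - (∑ v ∈ univ.erase h, PX (some h) (some v) + PX (some h) none))
    (hPXout : ∀ v, PX none (some v) = (NC v : ℝ) / K * acc a v) (hPXstay : PX none none = 1 - ∑ v, PX none (some v))
    (hPYoff : ∀ h v, h ≠ v → PY (some h) (some v) = if NC h = 0 then 0 else (NC v : ℝ) / K * acc h v)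
    (hPYin : ∀ h, PY (some h) none = if NC h = 0 then 0 else acc h b / K)
    (hPYdiag : ∀ h, PY (some h) (some h) = 1 - (∑ v ∈ univ.erase h, PY (some h) (some v) + PY (some h) none))
    (hPYout : ∀ v, PY none (some v) = (NC v : ℝ) / K * acc b v) (hPYstay : PY none none = 1 - ∑ v, PY none (some v))
    {z : S} (hz : NC z ≠ 0) {x y : ℕ → Option S → ℝ}
    (hx0 : ∀ v, x 0 v = if v = some z then 1 else 0) (hxs : ∀ n v, x (n + 1) v = ∑ h, x n h * PX h v)
    (hy0 : ∀ v, y 0 v = if v = some z then 1 else 0) (hys : ∀ n v, y (n + 1) v = ∑ h, y n h * PY h v) :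
    (W z ≤ W b → W z < W a → (2 ≤ NC z ∨ ∃ w, NC w ≠ 0 ∧ W z < W w) →
        (∀ n, y (n + 1) (some z) - x (n + 1) (some z)
            ≤ (if Odd n then (PX (some z) (some z) - PY (some z) (some z)) * (max 0 ((NC z : ℝ) / K - PX (some z) (some z))) ^ n else 0))
        ∧ (∀ σ : ℝ, 0 ≤ σ → σ ≤ 1 → ∀ J, ∑ n ∈ range J, (1 - σ) * σ ^ n * max 0 (y (n + 1) (some z) - x (n + 1) (some z))
            ≤ (1 - σ) * ((PX (some z) (some z) - PY (some z) (some z))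
                * (σ * max 0 ((NC z : ℝ) / K - PX (some z) (some z)) / (1 - (σ * max 0 ((NC z : ℝ) / K - PX (some z) (some z))) ^ 2)))))
    ∧ (W z ≤ W b → W z < W a → NC z = 1 → (∀ w, w ≠ z → NC w ≠ 0 → W w < W z) →
        (∀ n, y (n + 1) (some z) - x (n + 1) (some z) ≤ (if Odd n then (1 / (K : ℝ)) ^ (n + 1) * ((W z / W a) / (1 + W z / W a)) else 0))
        ∧ (∀ σ : ℝ, 0 ≤ σ → σ < 1 → ∀ J, ∑ n ∈ range J, (1 - σ) * σ ^ n * max 0 (y (n + 1) (some z) - x (n + 1) (some z))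
            ≤ (1 - σ) * ((W z / W a) / (1 + W z / W a) * (1 / (K : ℝ)) * (σ * (1 / (K : ℝ)) / (1 - (σ * (1 / (K : ℝ))) ^ 2)))))
    ∧ (W a < W z → (2 ≤ NC z ∨ ∃ w, w ≠ z ∧ NC w ≠ 0 ∧ W b < W w) → ∀ n, y n (some z) ≤ x n (some z))
    ∧ (W a < W z → NC z = 1 → (∀ w, w ≠ z → NC w ≠ 0 → W w < W b) →
        (∀ n, y (n + 1) (some z) - x (n + 1) (some z) ≤ (if Even n then (1 / (K : ℝ)) ^ (n + 1) * ((W b / W z) / (1 + W b / W z)) else 0))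
        ∧ (∀ σ : ℝ, 0 ≤ σ → σ < 1 → ∀ J, ∑ n ∈ range J, (1 - σ) * σ ^ n * max 0 (y (n + 1) (some z) - x (n + 1) (some z))
            ≤ (1 - σ) * ((W b / W z) / (1 + W b / W z) * (1 / (K : ℝ)) * ((σ * (1 / (K : ℝ))) ^ 2 / (1 - (σ * (1 / (K : ℝ))) ^ 2))))) := by
  classical
  -- chapter W's data on the content type `Option S` (verbatim from Z12)
  obtain ⟨N', hN'⟩ : ∃ N' : Option S → ℕ, ∀ o, N' o = Option.elim o 1 NC := ⟨_, fun _ => rfl⟩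
  obtain ⟨WX', hWX'⟩ : ∃ W' : Option S → ℝ, ∀ o, W' o = Option.elim o (W a) W := ⟨_, fun _ => rfl⟩
  obtain ⟨WY', hWY'⟩ : ∃ W' : Option S → ℝ, ∀ o, W' o = Option.elim o (W b) W := ⟨_, fun _ => rfl⟩
  obtain ⟨accX', haccX'⟩ : ∃ acc' : Option S → Option S → ℝ, ∀ h v, acc' h v = min 1 (WX' h / WX' v) := ⟨_, fun _ _ => rfl⟩
  obtain ⟨accY', haccY'⟩ : ∃ acc' : Option S → Option S → ℝ, ∀ h v, acc' h v = min 1 (WY' h / WY' v) := ⟨_, fun _ _ => rfl⟩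
  obtain ⟨offX, hoffX⟩ : ∃ off : (Option S → ℕ) → Option S → Option S → ℝ, ∀ M h v, off M h v = if M h = 0 then 0 else (M v : ℝ) / K * accX' h v :=
    ⟨_, fun _ _ _ => rfl⟩
  obtain ⟨offY, hoffY⟩ : ∃ off : (Option S → ℕ) → Option S → Option S → ℝ, ∀ M h v, off M h v = if M h = 0 then 0 else (M v : ℝ) / K * accY' h v :=
    ⟨_, fun _ _ _ => rfl⟩
  obtain ⟨KhX, hKhX⟩ : ∃ Kh : (Option S → ℕ) → Option S → Option S → ℝ, ∀ M h v, Kh M h v = if h = v then 1 - ∑ v' ∈ univ.erase h, offX M h v' else offX M h v :=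
    ⟨_, fun _ _ _ => rfl⟩
  obtain ⟨KhY, hKhY⟩ : ∃ Kh : (Option S → ℕ) → Option S → Option S → ℝ, ∀ M h v, Kh M h v = if h = v then 1 - ∑ v' ∈ univ.erase h, offY M h v' else offY M h v :=
    ⟨_, fun _ _ _ => rfl⟩
  have hKXoff : ∀ M h v, h ≠ v → KhX M h v = if M h = 0 then 0 else (M v : ℝ) / K * min 1 (WX' h / WX' v) := fun M h v hhv => by
    rw [hKhX, if_neg hhv, hoffX, haccX']
  have hKYoff : ∀ M h v, h ≠ v → KhY M h v = if M h = 0 then 0 else (M v : ℝ) / K * min 1 (WY' h / WY' v) := fun M h v hhv => by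
    rw [hKhY, if_neg hhv, hoffY, haccY']
  have hKXoff' : ∀ M h v, h ≠ v → KhX M h v = if M h = 0 then 0 else (M v : ℝ) / K * accX' h v := fun M h v hhv => by rw [hKXoff M h v hhv, haccX']
  have hKYoff' : ∀ M h v, h ≠ v → KhY M h v = if M h = 0 then 0 else (M v : ℝ) / K * accY' h v := fun M h v hhv => by rw [hKYoff M h v hhv, haccY']
  have hKXdiag : ∀ M h, KhX M h h = 1 - ∑ v ∈ univ.erase h, KhX M h v := fun M h => by
    rw [hKhX, if_pos rfl]; congr 1; exact sum_congr rfl fun v hv => by rw [hKhX, if_neg (ne_of_mem_erase hv).symm]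
  have hKYdiag : ∀ M h, KhY M h h = 1 - ∑ v ∈ univ.erase h, KhY M h v := fun M h => by
    rw [hKhY, if_pos rfl]; congr 1; exact sum_congr rfl fun v hv => by rw [hKhY, if_neg (ne_of_mem_erase hv).symm]
  have hPX : ∀ h v, PX h v = KhX N' h v := tagged_kernel_eq hacc hPXoff hPXin hPXdiag hPXout hPXstay hN' hWX' hKXoff hKXdiag
  have hPY : ∀ h v, PY h v = KhY N' h v := tagged_kernel_eq hacc hPYoff hPYin hPYdiag hPYout hPYstay hN' hWY' hKYoff hKYdiag
  let KhnX : ℕ → Option S → Option S → ℝ := fun n =>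
    Nat.rec (motive := fun _ => Option S → Option S → ℝ) (fun h v => if h = v then 1 else 0) (fun _ prev h v => ∑ w', prev h w' * KhX N' w' v) n
  let KhnY : ℕ → Option S → Option S → ℝ := fun n =>
    Nat.rec (motive := fun _ => Option S → Option S → ℝ) (fun h v => if h = v then 1 else 0) (fun _ prev h v => ∑ w', prev h w' * KhY N' w' v) n
  have hKhnX0 : ∀ h v, KhnX 0 h v = if h = v then 1 else 0 := fun _ _ => rfl
  have hKhnXs : ∀ n h v, KhnX (n + 1) h v = ∑ w', KhnX n h w' * KhX N' w' v := fun _ _ _ => rfl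
  have hKhnY0 : ∀ h v, KhnY 0 h v = if h = v then 1 else 0 := fun _ _ => rfl
  have hKhnYs : ∀ n h v, KhnY (n + 1) h v = ∑ w', KhnY n h w' * KhY N' w' v := fun _ _ _ => rfl
  have hxrow : ∀ n v, x n v = KhnX n (some z) v := by
    intro n; induction n with
    | zero => intro v; rw [hx0, hKhnX0]; by_cases h : v = some z <;> simp [h, eq_comm]
    | succ n ih => intro v; rw [hxs, hKhnXs]; exact sum_congr rfl fun h _ => by rw [ih, hPX]
  have hyrow : ∀ n v, y n v = KhnY n (some z) v := by
    intro n; induction n with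
    | zero => intro v; rw [hy0, hKhnY0]; by_cases h : v = some z <;> simp [h, eq_comm]
    | succ n ih => intro v; rw [hys, hKhnYs]; exact sum_congr rfl fun h _ => by rw [ih, hPY]
  -- the hypotheses of file 5
  have hWXpos : ∀ o, 0 < WX' o := fun o => by rw [hWX']; rcases o with _ | v <;> simp [hW]
  have hWYpos : ∀ o, 0 < WY' o := fun o => by rw [hWY']; rcases o with _ | v <;> simp [hW]
  have hagree : ∀ o, o ≠ none → WX' o = WY' o := fun o ho => by
    rcases o with _ | v
    · exact absurd rfl ho
    · rw [hWX', hWY']; rfl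
  have hWt : WY' none ≤ WX' none := by rw [hWX', hWY']; exact hab
  have hNK : ∑ o, (N' o : ℝ) = K + 1 := by
    have h1 : ∑ o, (N' o : ℝ) = 1 + ∑ v, (NC v : ℝ) := by rw [Fintype.sum_option]; simp [hN', Option.elim]
    have h2 : ∑ v, (NC v : ℝ) = K := by exact_mod_cast hNC
    rw [h1, h2]; ring
  have hNt : N' none = 1 := by rw [hN']; simp
  have hnone' : ∀ o, N' o ≠ 0 → o ≠ none → ¬ (WY' none < WX' o ∧ WX' o < WX' none) := by
    intro o ho hon
    rcases o with _ | w
    · exact absurd rfl hon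
    · rw [hWX', hWX', hWY']
      have hw : NC w ≠ 0 := by rw [hN'] at ho; exact ho
      exact hnone w hw
  -- a common sorted enumeration and the two ranks
  obtain ⟨m, e, he_inj, he_pres, he_cov, hkey⟩ := global_exists_sorted_enum N' (fun o => WX' o + WY' o) none
  obtain ⟨hsortX, hsortY⟩ := global_sorted_of_key hagree hWt hnone' he_inj he_pres hkey
  have hzN : N' (some z) ≠ 0 := by rw [hN']; exact hz
  have htN : N' none ≠ 0 := by rw [hNt]; exact one_ne_zero
  obtain ⟨i, hi, hiz⟩ := he_cov (some z) hzN
  obtain ⟨s, hs, hst⟩ := he_cov none htN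
  have his : i ≠ s := fun h => Option.some_ne_none z (by rw [← hiz, ← hst, h])
  obtain ⟨hA, hB, hC, hD⟩ := hubClass_startClass_deficit_of_enum hWXpos hWYpos hagree hWt haccX' haccY' hK hNK hNt hKXoff' hKXdiag hKYoff' hKYdiag hKhnX0 hKhnXs hKhnY0 hKhnYs
    he_inj he_pres he_cov hsortX hsortY hi hs hiz hst his
  -- reading ranks off strict persistence inequalities
  have hrank_lt : ∀ l l', l < m → l' < m → WX' (e l') < WX' (e l) → l < l' := by
    intro l l' hl hl' hlt
    by_contra hge
    exact absurd (hsortX l' l (by omega) hl) (not_le.mpr hlt)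
  have hrank_ltY : ∀ l l', l < m → l' < m → WY' (e l') < WY' (e l) → l < l' := by
    intro l l' hl hl' hlt
    by_contra hge
    exact absurd (hsortY l' l (by omega) hl) (not_le.mpr hlt)
  have hrank_key : ∀ l l', l < m → l' < m → WX' (e l') + WY' (e l') < WX' (e l) + WY' (e l) → l < l' := by
    intro l l' hl hl' hlt
    by_contra hge
    exact absurd (hkey l' l (by omega) hl) (not_le.mpr hlt)
  -- the tag precedes `z` as soon as `W_z ≤ W_b` and `W_z < W_a` (key `W^X + W^Y`: `W_a + W_b > 2W_z`)
  have hsi_of : W z ≤ W b → W z < W a → s < i := fun hzb hza =>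
    hrank_key s i hs hi (by rw [hiz, hst, hWX', hWX', hWY', hWY']; simp only [Option.elim]; linarith)
  have hN'z : N' (e i) = NC z := by rw [hiz, hN']; rfl
  have hN's : N' (e s) = 1 := by rw [hst, hNt]
  have hN'nn : ∀ l, (0 : ℝ) ≤ (N' (e l) : ℝ) := fun l => Nat.cast_nonneg _
  have hWz : WX' (e i) = W z := by rw [hiz, hWX']; rfl
  have hWzY : WY' (e i) = W z := by rw [hiz, hWY']; rfl
  have hWa : WX' (e s) = W a := by rw [hst, hWX']; rfl
  have hWb : WY' (e s) = W b := by rw [hst, hWY']; rfl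
  -- a third rank below a bound: the sum over `range (k+1)` dominates any two or three of its distinct terms
  have hsum2 : ∀ k l₁ l₂, l₁ ≤ k → l₂ ≤ k → l₁ ≠ l₂ → (N' (e l₁) : ℝ) + N' (e l₂) ≤ ∑ l ∈ range (k + 1), (N' (e l) : ℝ) := by
    intro k l₁ l₂ h1 h2 h12
    have hsub : ({l₁, l₂} : Finset ℕ) ⊆ range (k + 1) := by
      intro l hl; rw [mem_insert, mem_singleton] at hl; rw [mem_range]; omega
    calc (N' (e l₁) : ℝ) + N' (e l₂) = ∑ l ∈ ({l₁, l₂} : Finset ℕ), (N' (e l) : ℝ) := (sum_pair (f := fun l => (N' (e l) : ℝ)) h12).symm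
      _ ≤ _ := sum_le_sum_of_subset_of_nonneg hsub fun l _ _ => hN'nn l
  have hsum3 : ∀ k l₁ l₂ l₃, l₁ ≤ k → l₂ ≤ k → l₃ ≤ k → l₁ ≠ l₂ → l₁ ≠ l₃ → l₂ ≠ l₃ →
      (N' (e l₁) : ℝ) + N' (e l₂) + N' (e l₃) ≤ ∑ l ∈ range (k + 1), (N' (e l) : ℝ) := by
    intro k l₁ l₂ l₃ h1 h2 h3 h12 h13 h23
    have hsub : ({l₁, l₂, l₃} : Finset ℕ) ⊆ range (k + 1) := by
      intro l hl; simp only [mem_insert, mem_singleton] at hl; rw [mem_range]; omega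
    have hnot : l₁ ∉ ({l₂, l₃} : Finset ℕ) := by simp [h12, h13]
    calc (N' (e l₁) : ℝ) + N' (e l₂) + N' (e l₃) = ∑ l ∈ ({l₁, l₂, l₃} : Finset ℕ), (N' (e l) : ℝ) := by
          rw [sum_insert hnot, sum_pair (f := fun l => (N' (e l) : ℝ)) h23]; ring
      _ ≤ _ := sum_le_sum_of_subset_of_nonneg hsub fun l _ _ => hN'nn l
  refine ⟨fun hzb hza hthree => ?_, fun hzb hza hNz hbelow => ?_, fun haz hthree => ?_, fun haz hNz hbelow => ?_⟩
  · -- (A): `s < i` and three particles at ranks `≤ i`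
    have hsi : s < i := hsi_of hzb hza
    have h3 : (3 : ℝ) ≤ ∑ l ∈ range (i + 1), (N' (e l) : ℝ) := by
      rcases hthree with hz2 | ⟨w, hw, hzw⟩
      · have h := hsum2 i s i hsi.le le_rfl (ne_of_lt hsi)
        rw [hN's, hN'z] at h
        push_cast at h
        have : (2 : ℝ) ≤ (NC z : ℝ) := by exact_mod_cast hz2
        linarith
      · obtain ⟨l, hl, hlw⟩ := he_cov (some w) (by rw [hN']; exact hw)
        have hli : l < i := hrank_lt l i hl hi (by rw [hWz, hlw, hWX']; exact hzw)
        have hls : l ≠ s := fun h => Option.some_ne_none w (by rw [← hlw, ← hst, h])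
        have h := hsum3 i s i l hsi.le le_rfl hli.le (ne_of_lt hsi) (Ne.symm hls) (ne_of_gt hli)
        rw [hN's, hN'z, hlw] at h
        push_cast at h
        have h1 : (1 : ℝ) ≤ (NC z : ℝ) := by exact_mod_cast Nat.one_le_iff_ne_zero.mpr hz
        have h2 : (1 : ℝ) ≤ (N' (some w) : ℝ) := by rw [hN']; exact_mod_cast Nat.one_le_iff_ne_zero.mpr hw
        linarith
    obtain ⟨hA1, hA2⟩ := hA hsi h3
    have hNz' : N' (some z) = NC z := by rw [hN']; rfl
    refine ⟨fun n => ?_, fun σ hσ0 hσ1 J => ?_⟩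
    · have h := hA1 n
      rw [hNz'] at h
      rw [hxrow, hyrow, hPX, hPY]; exact h
    · have h := hA2 σ hσ0 hσ1 J
      rw [hNz'] at h
      rw [hPX, hPY]
      refine le_trans (le_of_eq (sum_congr rfl fun n _ => ?_)) h
      rw [hxrow, hyrow]
  · -- (B): `s = 0`, `i = 1`
    have hsi : s < i := hsi_of hzb hza
    have hothers : ∀ l, l < m → l ≠ s → l ≠ i → i < l := by
      intro l hl hls hli
      have hpres := he_pres l hl
      obtain ⟨w, hw⟩ : ∃ w, e l = some w := by
        rcases h : e l with _ | w
        · exact absurd (he_inj l s hl hs (by rw [h, hst])) hls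
        · exact ⟨w, rfl⟩
      have hwz : w ≠ z := fun h => hli (he_inj l i hl hi (by rw [hw, hiz, h]))
      have hNw : NC w ≠ 0 := by rw [hw, hN'] at hpres; exact hpres
      exact hrank_lt i l hi hl (by rw [hWz, hw, hWX']; exact hbelow w hwz hNw)
    have hs0 : s = 0 := by
      by_contra h
      have h0 : (0 : ℕ) < m := by omega
      rcases Nat.eq_or_lt_of_le (Nat.zero_le i) with hi0 | hi0
      · exact absurd hi0.symm (by omega)
      · have := hothers 0 h0 (Ne.symm h) (by omega); omega
    have hi1 : i = 1 := by
      by_contra h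
      have h1 : (1 : ℕ) < m := by omega
      have := hothers 1 h1 (by omega) (Ne.symm h); omega
    obtain ⟨hB1, hB2⟩ := hB hs0 hi1 (by rw [hN']; exact hNz)
    have hWt' : WX' none = W a := by rw [hWX']; rfl
    have hWz' : WX' (some z) = W z := by rw [hWX']; rfl
    refine ⟨fun n => ?_, fun σ hσ0 hσ1 J => ?_⟩
    · have h := hB1 n
      rw [hWt', hWz'] at h
      rw [hxrow, hyrow]; exact h
    · have h := hB2 σ hσ0 hσ1 J
      rw [hWt', hWz'] at h
      refine le_trans (le_of_eq (sum_congr rfl fun n _ => ?_)) h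
      rw [hxrow, hyrow]
  · -- (C): `i < s` and three particles at ranks `≤ s`
    have his' : i < s := hrank_lt i s hi hs (by rw [hWz, hWa]; exact haz)
    have h3 : (3 : ℝ) ≤ ∑ l ∈ range (s + 1), (N' (e l) : ℝ) := by
      rcases hthree with hz2 | ⟨w, hwz, hw, hbw⟩
      · have h := hsum2 s i s his'.le le_rfl (ne_of_lt his')
        rw [hN's, hN'z] at h
        push_cast at h
        have : (2 : ℝ) ≤ (NC z : ℝ) := by exact_mod_cast hz2
        linarith
      · obtain ⟨l, hl, hlw⟩ := he_cov (some w) (by rw [hN']; exact hw)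
        have hls : l < s := hrank_ltY l s hl hs (by rw [hWb, hlw, hWY']; exact hbw)
        have hli : l ≠ i := fun h => hwz (Option.some_inj.mp (by rw [← hlw, ← hiz, h]))
        have h := hsum3 s i s l his'.le le_rfl hls.le (ne_of_lt his') hli.symm (ne_of_gt hls)
        rw [hN's, hN'z, hlw] at h
        push_cast at h
        have h1 : (1 : ℝ) ≤ (NC z : ℝ) := by exact_mod_cast Nat.one_le_iff_ne_zero.mpr hz
        have h2 : (1 : ℝ) ≤ (N' (some w) : ℝ) := by rw [hN']; exact_mod_cast Nat.one_le_iff_ne_zero.mpr hw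
        linarith
    intro n
    have h := hC his' h3 n
    rw [hxrow, hyrow]; exact h
  · -- (D): `i = 0`, `s = 1`
    have his' : i < s := hrank_lt i s hi hs (by rw [hWz, hWa]; exact haz)
    have hothers : ∀ l, l < m → l ≠ s → l ≠ i → s < l := by
      intro l hl hls hli
      have hpres := he_pres l hl
      obtain ⟨w, hw⟩ : ∃ w, e l = some w := by
        rcases h : e l with _ | w
        · exact absurd (he_inj l s hl hs (by rw [h, hst])) hls
        · exact ⟨w, rfl⟩
      have hwz : w ≠ z := fun h => hli (he_inj l i hl hi (by rw [hw, hiz, h]))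
      have hNw : NC w ≠ 0 := by rw [hw, hN'] at hpres; exact hpres
      exact hrank_ltY s l hs hl (by rw [hWb, hw, hWY']; exact hbelow w hwz hNw)
    have hi0 : i = 0 := by
      by_contra h
      have h0 : (0 : ℕ) < m := by omega
      have := hothers 0 h0 (by omega) (Ne.symm h); omega
    have hs1 : s = 1 := by
      by_contra h
      have h1 : (1 : ℕ) < m := by omega
      rcases Nat.lt_or_ge 1 s with hlt | hge
      · have := hothers 1 h1 (by omega) (by omega); omega
      · omega
    obtain ⟨hD1, hD2⟩ := hD hi0 hs1 (by rw [hN']; exact hNz)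
    have hWt' : WY' none = W b := by rw [hWY']; rfl
    have hWz' : WX' (some z) = W z := by rw [hWX']; rfl
    refine ⟨fun n => ?_, fun σ hσ0 hσ1 J => ?_⟩
    · have h := hD1 n
      rw [hWt', hWz'] at h
      rw [hxrow, hyrow]; exact h
    · have h := hD2 σ hσ0 hσ1 J
      rw [hWt', hWz'] at h
      refine le_trans (le_of_eq (sum_congr rfl fun n _ => ?_)) h
      rw [hxrow, hyrow]

end TaggedDeficit

end Summit.Ventures.LatticeQCDFlow.Scaling
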